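import Summits.CriticalPhenomena.SAWScalingLimit.Theorems.SAWTotalPositivityTPToTraversalBoundDiveDefs
import Literature.Probability.RandomPlanarGeometry.PolylineShellTraversals

/-!
# Polyline traversals give lattice traversals of the shrunk shell — stub `hasNTrav_of_hasTraversals`

Line `exit-mass-unforced-dive` of the crux `SAWTotalPositivity.TPToTraversalBound`
(stmt-CriticalPhenomena-10687).  This file proves the registered conversion stub
`hasNTrav_of_hasTraversals` (vocabulary `rad`, `IsTraversal`, `HasNTrav` in
`…TPToTraversalBoundDiveDefs.lean`): if the mesh polyline `w.toCurve (meshPoint δ)` of a lattice walk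
`w` of `Ω_δ = discreteDomainGraph Ω δ` (`δ > 0`) traverses the shell `D(x; ρ, R)` by `k` separate
segments (`Curve.HasTraversals`, Aizenman–Burchard's event (1.3)) and `ρ + δ < R - δ`, then the vertex
walk `w` makes `k` index-disjoint LATTICE traversals of the shrunk annulus `A(x; ρ + δ, R - δ)`
(`HasNTrav δ x (ρ + δ) (R - δ) w k`).

## Proof

`w.toCurve (meshPoint δ) = polyline (w.support.map (meshPoint δ))` and consecutive mesh points of
`w` are at distance `≤ δ` (adjacent sites of `ℤ²`), so
`vertexTraversals_of_hasTraversals_polyline` (`Literature/…/PolylineShellTraversals.lean`) yields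
`k` WEAK vertex traversals `ι m ≤ κ m` of `D(x; ρ + δ, R - δ)` by the support, `κ m ≤ ι m'` for
`m < m'`.  Each is cleaned into a lattice traversal `[i, j] ⊆ [ι, κ]` (`exists_clean_traversal`):
`j` is the least index after `ι` on the far side and `i` the greatest index before `j` on the near
side, so that every vertex strictly between is strictly inside the open annulus; `ρ + δ < R - δ`
makes the two sides disjoint.  Disjointness in order is inherited: `j m ≤ κ m ≤ ι m' ≤ i m'`.

Sources: M. Aizenman, A. Burchard, Duke Math. J. 99 (1999) §1.b (1.3) and §3.a (discretisation of
traversal counts); A. Kemppainen, S. Smirnov, Ann. Probab. 45 (2017), §3.2 (lattice crossings).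
Deliberately NOT here: anything about the other stubs of the line; no definitions.
-/

noncomputable section

open Literature.Probability.LatticeModels
open Literature.Probability.RandomPlanarGeometry
open Summit.CriticalPhenomena.SAWScalingLimit.Theses.SAWTotalPositivity

namespace Summit.CriticalPhenomena.SAWScalingLimit.Theorems.TPToTraversalBound.ExitMass

/-! ## Cleaning a weak traversal -/

/-- **Clean-up of a weak traversal (abstract form).**  If `P ι`, `Q κ`, `ι ≤ κ` and no index
satisfies both `P` and `Q`, then there are `ι ≤ i < j ≤ κ` with `P i`, `Q j` and neither `P` nor `Q`
strictly between: `j` is the least index in `[ι, κ]` satisfying `Q`, `i` the greatest index in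
`[ι, j)` satisfying `P`. [folklore] -/
private theorem exists_clean_traversal {P Q : ℕ → Prop} (hPQ : ∀ n, P n → Q n → False) {ι κ : ℕ}
    (hικ : ι ≤ κ) (hP : P ι) (hQ : Q κ) :
    ∃ i j, ι ≤ i ∧ i < j ∧ j ≤ κ ∧ P i ∧ Q j ∧ ∀ l, i < l → l < j → ¬ P l ∧ ¬ Q l := by
  classical
  have hex : ∃ n, ι ≤ n ∧ n ≤ κ ∧ Q n := ⟨κ, hικ, le_rfl, hQ⟩
  obtain ⟨hιj, hjκ, hQj⟩ := Nat.find_spec hex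
  have hmin : ∀ n, n < Nat.find hex → ι ≤ n → ¬ Q n := fun n hn hιn hQn =>
    Nat.find_min hex hn ⟨hιn, hn.le.trans hjκ, hQn⟩
  have hιj' : ι < Nat.find hex :=
    lt_of_le_of_ne hιj fun h => hPQ ι hP (by rw [h]; exact hQj)
  have hι1 : ι ≤ Nat.find hex - 1 := by omega
  have hspec := Nat.findGreatest_spec (P := fun n => ι ≤ n ∧ P n) hι1 ⟨le_rfl, hP⟩
  refine ⟨Nat.findGreatest (fun n => ι ≤ n ∧ P n) (Nat.find hex - 1), Nat.find hex, hspec.1,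
    (Nat.findGreatest_le _).trans_lt (by omega), hjκ, hspec.2, hQj, fun l hil hlj => ?_⟩
  have hιl : ι ≤ l := hspec.1.trans hil.le
  exact ⟨fun hPl => Nat.findGreatest_is_greatest hil (by omega) ⟨hιl, hPl⟩, hmin l hlj hιl⟩

/-- **Clean-up of a weak vertex traversal of a lattice walk.**  If `r < R`, `ι ≤ κ ≤ w.length` and
the vertices `w ι`, `w κ` lie on opposite sides of the annulus `A(z₀, r, R)` (closed inner disc /
outside the open outer disc), then some index segment `[i, j] ⊆ [ι, κ]` is a lattice traversal
`IsTraversal δ z₀ r R w i j`. [folklore] -/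
private theorem exists_isTraversal_of_weak {Ω : Set ℂ} {δ : ℝ} {z₀ : ℂ} {r R : ℝ} (hrR : r < R)
    {u v : Site 2} (w : (discreteDomainGraph Ω δ).Walk u v) {ι κ : ℕ} (hικ : ι ≤ κ)
    (hκ : κ ≤ w.length)
    (h : (rad δ z₀ (w.getVert ι) ≤ r ∧ R ≤ rad δ z₀ (w.getVert κ)) ∨
      (R ≤ rad δ z₀ (w.getVert ι) ∧ rad δ z₀ (w.getVert κ) ≤ r)) :
    ∃ i j, ι ≤ i ∧ j ≤ κ ∧ IsTraversal δ z₀ r R w i j := by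
  rcases h with ⟨hι, hκ'⟩ | ⟨hι, hκ'⟩
  · obtain ⟨i, j, hιi, hij, hjκ, hPi, hQj, hint⟩ := exists_clean_traversal
      (P := fun n => rad δ z₀ (w.getVert n) ≤ r) (Q := fun n => R ≤ rad δ z₀ (w.getVert n))
      (fun _ hp hq => lt_irrefl _ ((hq.trans hp).trans_lt hrR)) hικ hι hκ'
    exact ⟨i, j, hιi, hjκ, hij, hjκ.trans hκ, Or.inl ⟨hPi, hQj⟩, fun l h1 h2 =>
      ⟨not_le.1 (hint l h1 h2).1, not_le.1 (hint l h1 h2).2⟩⟩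
  · obtain ⟨i, j, hιi, hij, hjκ, hPi, hQj, hint⟩ := exists_clean_traversal
      (P := fun n => R ≤ rad δ z₀ (w.getVert n)) (Q := fun n => rad δ z₀ (w.getVert n) ≤ r)
      (fun _ hp hq => lt_irrefl _ ((hp.trans hq).trans_lt hrR)) hικ hι hκ'
    exact ⟨i, j, hιi, hjκ, hij, hjκ.trans hκ, Or.inr ⟨hPi, hQj⟩, fun l h1 h2 =>
      ⟨not_le.1 (hint l h1 h2).2, not_le.1 (hint l h1 h2).1⟩⟩

/-! ## The stub -/

/-- **Separate traversals of the mesh polyline give lattice traversals of the shrunk annulus**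
(registered stub `hasNTrav_of_hasTraversals` of the line `exit-mass-unforced-dive`, crux
`TPToTraversalBound`): for a lattice walk `w` of `Ω_δ`, `δ > 0`, and `ρ + δ < R - δ`, if the mesh
polyline `w.toCurve (meshPoint δ)` traverses `D(x; ρ, R)` by `k` separate segments then `w` makes `k`
index-disjoint lattice traversals of `A(x; ρ + δ, R - δ)`, in order.  Each traversal time is replaced
by the index of the mesh edge occupied at that time (monotonically, at the cost of one mesh step on
each side of the shell), and each weak vertex traversal so obtained is cleaned into a lattice one.
[cite: AizenmanBurchard1999, §3.a (proof of Lemma 3.1)] -/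
theorem hasNTrav_of_hasTraversals : ∀ {Ω : Set ℂ} {δ : ℝ}, 0 < δ → ∀ {u v : Site 2} (w : (discreteDomainGraph Ω δ).Walk u v) {k : ℕ} {x : ℂ} {ρ R : ℝ}, ρ + δ < R - δ → (⟨w.toCurve (meshPoint δ)⟩ : Curve ℂ).HasTraversals k x ρ R → HasNTrav δ x (ρ + δ) (R - δ) w k := by
  intro Ω δ hδ u v w k x ρ R hρR h
  -- consecutive mesh points of the walk are `δ`-close
  have hchain : List.IsChain (fun p q : ℂ => dist p q ≤ δ) (w.support.map (meshPoint δ)) := by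
    refine List.isChain_map_of_isChain (meshPoint δ) (fun a b hab => ?_) w.isChain_adj_support
    obtain ⟨-, -, hsum⟩ := abs_re_im_meshPoint_sub_of_adj hδ.le
      (meshGraph_le_zdGraph Ω δ (discreteDomainGraph_le_meshGraph Ω δ hab))
    rw [dist_comm, dist_eq_norm]
    exact (Complex.norm_le_abs_re_add_abs_im _).trans_eq hsum
  -- the support list as a cons
  have hl : w.support.map (meshPoint δ) = meshPoint δ u :: w.support.tail.map (meshPoint δ) := by
    conv_lhs => rw [← w.cons_tail_support]
    rfl
  rw [hl] at hchain
  have h' : (⟨polyline (meshPoint δ u :: w.support.tail.map (meshPoint δ))⟩ : Curve ℂ).HasTraversals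
      k x ρ R := by
    rw [← hl]
    exact h
  obtain ⟨ι, κ, hικ, hends, hsep⟩ := vertexTraversals_of_hasTraversals_polyline hδ.le hchain h'
  -- dictionary: points of the list are the mesh points of the vertices of `w`
  have hlen : (meshPoint δ u :: w.support.tail.map (meshPoint δ)).length = w.length + 1 := by
    rw [← hl, List.length_map, SimpleGraph.Walk.length_support]
  have hget : ∀ (n : ℕ) (hn : n < (meshPoint δ u :: w.support.tail.map (meshPoint δ)).length),
      (meshPoint δ u :: w.support.tail.map (meshPoint δ))[n] = meshPoint δ (w.getVert n) := by
    intro n hn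
    have hn' : n ≤ w.length := by omega
    rw [List.getElem_eq_iff, ← hl, List.getElem?_map, ← w.getVert_eq_support_getElem? hn']
    rfl
  -- clean each weak vertex traversal into a lattice traversal inside it
  have hclean : ∀ m, ∃ i j, (ι m : ℕ) ≤ i ∧ j ≤ (κ m : ℕ) ∧
      IsTraversal δ x (ρ + δ) (R - δ) w i j := by
    intro m
    refine exists_isTraversal_of_weak hρR w (Fin.le_def.1 (hικ m))
      (by have := (κ m).isLt; omega) ?_
    have hm := hends m
    simp only [List.get_eq_getElem] at hm
    rw [hget _ (ι m).isLt, hget _ (κ m).isLt] at hm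
    exact hm
  choose i j hi hj htrav using hclean
  exact ⟨i, j, htrav, fun m m' hmm' => (hj m).trans ((Fin.le_def.1 (hsep hmm')).trans (hi m'))⟩

end Summit.CriticalPhenomena.SAWScalingLimit.Theorems.TPToTraversalBound.ExitMass

end
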